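import Summits.Ventures.CertifiedManyBodySolver.Downfold.EmeryAntibondingBand
import HarnessLib

/-!
# A CERTIFIED FLOOR on the one-band-form misfit of the σ three-band (Emery) model: no
# energy-independent `t–t′–t″` dispersion reproduces the antibonding band

Venture CertifiedManyBodySolver, cell `pub/hubbard-downfold` (stage S1, HUMAN RULINGS D-0096/D-0098:
the three-band → one-band reduction error is carried explicitly), seat hubbard-downfold-mod-4 (technique B);
namespace `Summit.Ventures.CertifiedManyBodySolver.Downfold.Emery`. Everything here is PROVED. WHAT
THIS IS NOT: not a statement about any material; the per-set numbers (certificates) live in the cell's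
`router/INFLATION-RULES-3to1-B.md` §B.13 and are SCREENING-GRADE by their inputs; this file is the
kernel that checks such a certificate.

`EmeryFermiSurfaceShape` shows that the secular function `charCubic(x, y, ε)` of the σ model is, at fixed
`ε`, bilinear in `x = sin²(kx/2)`, `y = sin²(ky/2)`, so each constant-energy contour is a `t–t′` contour
with ENERGY-DEPENDENT ratio; an energy-INDEPENDENT `t–t′–t″` form (the symmetric quadratics in `(x, y)`,
`oneBandXY_eq_symQuad`) therefore cannot follow the band (`EmeryAntibondingBand.abBand`) exactly. This
file quantifies that:

* §1 THE ANNIHILATOR PRINCIPLE (`abs_sum_mul_le_of_near`, `sum_mul_oneBandXY_eq_zero`,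
  `misfit_floor_of_certificate`): if weights `w_i` at points `(x_i, y_i)` kill the four moments
  `1, x + y, xy, x² + y²` (hence every `t–t′–t″` form) and `ν_i ≤ ε_AB(x_i, y_i) ≤ μ_i`, then EVERY
  one-band form misses the band by more than `δ` at one of the points whenever
  `δ·Σ|w_i| < Σ_i (w_i ν_i if w_i ≥ 0 else w_i μ_i)` — a finite, exact-rational certificate
  (`sin_sq_half_two_arcsin_sqrt`: every `(x, y) ∈ [0,1]²` is a k-point, so these are statements at
  explicit k where `oneBandXY = EmeryBlochBand.oneBand`).
* §2 THE UNIVERSAL AXIS FLOOR (`thirdDiff_sqrt_pos`, `axisFloor_pos`, `axis_misfit_floor`): for every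
  `Δ ≥ 0`, `t_pd ≠ 0` (any `t_pp`; `t_pp′ = 0`) and EVERY `(c, t, t′, t″)`, on the Γ–X axis at
  `sin²(kx/2) ∈ {0, ⅓, ⅔, 1}` the σ antibonding band misses the one-band form by at least
  `axisFloor = (√(Δ² + 16t_pd²) − 3√(Δ² + 32t_pd²/3) + 3√(Δ² + 16t_pd²/3) − Δ)/16 > 0` — the third
  difference of the exact axis dispersion, which no quadratic in `x` can absorb: the band-level 3 → 1
  misfit is NEVER zero.

* §3 (appended after hubbard-downfold-unc-3's REVIEW v3): `misfit_floor_of_certificate_neg` (the sign twin,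
  opposite orientation of the weights) and `misfit_floor_of_certificate_k` (the conclusion composed to the
  explicit k-points `(2·arcsin √x_i, 2·arcsin √y_i)` and the D0 dispersion `EmeryBlochBand.oneBand`).

Sources: three-band model [HybertsenSchluterChristensen1989, Eq. (1)]; `t, t′, t″` one-band language and
the remark that farther hoppings are needed beyond first order [AndersenEtAl1995, §6]. The mathematics
(moment annihilators, divided differences of `√`) is elementary.
-/

noncomputable section

namespace Summit.Ventures.CertifiedManyBodySolver.Downfold.Emery

open Real

/-! ## §1 The annihilator principle: a finite certificate bounds the misfit of EVERY one-band form -/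

/-- If `Σ w_i q_i = 0` and `|F_i − q_i| ≤ δ` on `s` then `|Σ w_i F_i| ≤ δ Σ|w_i|`. [folklore] -/
theorem abs_sum_mul_le_of_near {ι : Type*} (s : Finset ι) (w F q : ι → ℝ) (δ : ℝ)
    (hq : ∑ i ∈ s, w i * q i = 0) (hnear : ∀ i ∈ s, |F i - q i| ≤ δ) :
    |∑ i ∈ s, w i * F i| ≤ δ * ∑ i ∈ s, |w i| := by
  have hrew : ∑ i ∈ s, w i * F i = ∑ i ∈ s, w i * (F i - q i) := by
    have : ∑ i ∈ s, w i * (F i - q i) = ∑ i ∈ s, w i * F i - ∑ i ∈ s, w i * q i := by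
      rw [← Finset.sum_sub_distrib]
      apply Finset.sum_congr rfl
      intro i _
      ring
    rw [this, hq, sub_zero]
  rw [hrew]
  calc |∑ i ∈ s, w i * (F i - q i)| ≤ ∑ i ∈ s, |w i * (F i - q i)| := Finset.abs_sum_le_sum_abs _ _
    _ = ∑ i ∈ s, |w i| * |F i - q i| := by
        apply Finset.sum_congr rfl
        intro i _
        exact abs_mul _ _
    _ ≤ ∑ i ∈ s, |w i| * δ := by
        apply Finset.sum_le_sum
        intro i hi
        exact mul_le_mul_of_nonneg_left (hnear i hi) (abs_nonneg _)
    _ = δ * ∑ i ∈ s, |w i| := by rw [← Finset.sum_mul]; ring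

/-- Contrapositive: if `δ Σ|w_i| < |Σ w_i F_i|` and `Σ w_i q_i = 0` then some `|F_i − q_i| > δ`.
[folklore] -/
theorem exists_far_of_lt {ι : Type*} (s : Finset ι) (w F q : ι → ℝ) (δ : ℝ)
    (hq : ∑ i ∈ s, w i * q i = 0) (hlt : δ * ∑ i ∈ s, |w i| < |∑ i ∈ s, w i * F i|) :
    ∃ i ∈ s, δ < |F i - q i| := by
  by_contra h
  push Not at h
  have := abs_sum_mul_le_of_near s w F q δ hq h
  linarith

/-- MOMENT CONDITIONS KILL THE ONE-BAND FAMILY: if `Σ w_i = 0`, `Σ w_i (x_i + y_i) = 0`,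
`Σ w_i x_i y_i = 0`, `Σ w_i (x_i² + y_i²) = 0` then `Σ w_i · oneBandXY c t t′ t″ (x_i, y_i) = 0` for
every `(c, t, t′, t″)`. [folklore] -/
theorem sum_mul_oneBandXY_eq_zero {ι : Type*} (s : Finset ι) (w x y : ι → ℝ)
    (h0 : ∑ i ∈ s, w i = 0) (h1 : ∑ i ∈ s, w i * (x i + y i) = 0)
    (h2 : ∑ i ∈ s, w i * (x i * y i) = 0) (h3 : ∑ i ∈ s, w i * (x i ^ 2 + y i ^ 2) = 0)
    (c t t' t'' : ℝ) :
    ∑ i ∈ s, w i * oneBandXY c t t' t'' (x i) (y i) = 0 := by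
  have hterm : ∀ i ∈ s, w i * oneBandXY c t t' t'' (x i) (y i) =
      (c - 4 * t - 4 * t' - 4 * t'') * w i + (4 * t + 8 * t' + 16 * t'') * (w i * (x i + y i))
        + (-16 * t') * (w i * (x i * y i)) + (-16 * t'') * (w i * (x i ^ 2 + y i ^ 2)) := by
    intro i _
    rw [oneBandXY_eq_symQuad]
    ring
  rw [Finset.sum_congr rfl hterm]
  simp only [Finset.sum_add_distrib, ← Finset.mul_sum]
  rw [h0, h1, h2, h3]
  ring

/-- The certified lower end of `Σ w_i F_i` from enclosures `ν_i ≤ F_i ≤ μ_i`: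
`Σ (w_i ν_i if w_i ≥ 0 else w_i μ_i) ≤ Σ w_i F_i`. [folklore] -/
theorem sum_ite_le_sum_mul {ι : Type*} (s : Finset ι) (w F ν μ : ι → ℝ)
    (henc : ∀ i ∈ s, ν i ≤ F i ∧ F i ≤ μ i) :
    ∑ i ∈ s, (if 0 ≤ w i then w i * ν i else w i * μ i) ≤ ∑ i ∈ s, w i * F i := by
  apply Finset.sum_le_sum
  intro i hi
  obtain ⟨hlo, hhi⟩ := henc i hi
  split_ifs with hw
  · exact mul_le_mul_of_nonneg_left hlo hw
  · push Not at hw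
    exact mul_le_mul_of_nonpos_left hhi hw.le

/-- THE CERTIFICATE THEOREM: points `(x_i, y_i)`, weights `w_i` killing the four moments, enclosures
`ν_i ≤ ε_AB(x_i, y_i) ≤ μ_i`, and a `δ` with `δ·Σ|w_i| < Σ (w_i ν_i if w_i ≥ 0 else w_i μ_i)` certify
that EVERY one-band `t–t′–t″` dispersion misses the σ antibonding band by MORE than `δ` at one of the
points. [folklore] -/
theorem misfit_floor_of_certificate {ι : Type*} (s : Finset ι) (w x y ν μ : ι → ℝ)
    (Δ tpd tpp cc δ : ℝ)
    (h0 : ∑ i ∈ s, w i = 0) (h1 : ∑ i ∈ s, w i * (x i + y i) = 0)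
    (h2 : ∑ i ∈ s, w i * (x i * y i) = 0) (h3 : ∑ i ∈ s, w i * (x i ^ 2 + y i ^ 2) = 0)
    (henc : ∀ i ∈ s, ν i ≤ abBand Δ tpd tpp cc (x i) (y i) ∧ abBand Δ tpd tpp cc (x i) (y i) ≤ μ i)
    (hδ : δ * ∑ i ∈ s, |w i| < ∑ i ∈ s, (if 0 ≤ w i then w i * ν i else w i * μ i))
    (c t t' t'' : ℝ) :
    ∃ i ∈ s, δ < |abBand Δ tpd tpp cc (x i) (y i) - oneBandXY c t t' t'' (x i) (y i)| := by
  apply exists_far_of_lt s w _ _ δ (sum_mul_oneBandXY_eq_zero s w x y h0 h1 h2 h3 c t t' t'')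
  have hle := sum_ite_le_sum_mul s w (fun i => abBand Δ tpd tpp cc (x i) (y i)) ν μ henc
  have hpos : δ * ∑ i ∈ s, |w i| < ∑ i ∈ s, w i * abBand Δ tpd tpp cc (x i) (y i) :=
    lt_of_lt_of_le hδ hle
  exact lt_of_lt_of_le hpos (le_abs_self _)

/-- The half-angle variable of `kx = 2·arcsin √x` is `x` (`0 ≤ x ≤ 1`): every point of the unit square
is a `(sin²(kx/2), sin²(ky/2))`, so certificates in `(x, y)` are statements at explicit k-points and
`oneBandXY` there is `EmeryBlochBand.oneBand` (`oneBand_eq_oneBandXY`). [folklore] -/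
theorem sin_sq_half_two_arcsin_sqrt {x : ℝ} (hx0 : 0 ≤ x) (hx1 : x ≤ 1) :
    Real.sin (2 * Real.arcsin (Real.sqrt x) / 2) ^ 2 = x := by
  rw [show 2 * Real.arcsin (Real.sqrt x) / 2 = Real.arcsin (Real.sqrt x) by ring]
  have h1 : Real.sqrt x ≤ 1 := by
    rw [show (1 : ℝ) = Real.sqrt 1 from Real.sqrt_one.symm]
    exact Real.sqrt_le_sqrt hx1
  have h0 : -1 ≤ Real.sqrt x := by linarith [Real.sqrt_nonneg x]
  rw [Real.sin_arcsin h0 h1, Real.sq_sqrt hx0]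

/-! ## §2 The universal Γ–X axis floor: the misfit is never zero -/

/-- Third differences of `√` on an arithmetic progression are POSITIVE: for `A ≥ 0`, `δ > 0`,
`√(A + 3δ) − 3√(A + 2δ) + 3√(A + δ) − √A > 0`. [folklore] -/
theorem thirdDiff_sqrt_pos {A δ : ℝ} (hA : 0 ≤ A) (hδ : 0 < δ) :
    0 < Real.sqrt (A + 3 * δ) - 3 * Real.sqrt (A + 2 * δ) + 3 * Real.sqrt (A + δ) - Real.sqrt A := by
  set u0 := Real.sqrt A with hu0
  set u1 := Real.sqrt (A + δ) with hu1
  set u2 := Real.sqrt (A + 2 * δ) with hu2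
  set u3 := Real.sqrt (A + 3 * δ) with hu3
  have h0 : 0 ≤ u0 := Real.sqrt_nonneg _
  have h1 : 0 ≤ u1 := Real.sqrt_nonneg _
  have h2 : 0 ≤ u2 := Real.sqrt_nonneg _
  have h3 : 0 ≤ u3 := Real.sqrt_nonneg _
  have s0 : u0 ^ 2 = A := Real.sq_sqrt hA
  have s1 : u1 ^ 2 = A + δ := Real.sq_sqrt (by linarith)
  have s2 : u2 ^ 2 = A + 2 * δ := Real.sq_sqrt (by linarith)
  have s3 : u3 ^ 2 = A + 3 * δ := Real.sq_sqrt (by linarith)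
  -- Q = u0 u2 < A + δ  (since Q² = A(A+2δ) < (A+δ)²)
  have hQ : u0 * u2 < A + δ := by
    have hsq : (u0 * u2) ^ 2 < (A + δ) ^ 2 := by
      rw [mul_pow, s0, s2]; nlinarith
    exact lt_of_pow_lt_pow_left₀ 2 (by linarith) hsq
  -- P = u1 u3 > Q + δ  (since P² = (A+δ)(A+3δ) > (Q+δ)²)
  have hP : u0 * u2 + δ < u1 * u3 := by
    have hsq : (u0 * u2 + δ) ^ 2 < (u1 * u3) ^ 2 := by
      rw [mul_pow u1, s1, s3]
      have hQ2 : (u0 * u2) ^ 2 = A * (A + 2 * δ) := by rw [mul_pow, s0, s2]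
      nlinarith [hQ2, hQ, mul_nonneg h0 h2]
    exact lt_of_pow_lt_pow_left₀ 2 (mul_nonneg h1 h3) hsq
  -- (3u2 + u0)² < (u3 + 3u1)²
  have hfin : (3 * u2 + u0) ^ 2 < (u3 + 3 * u1) ^ 2 := by nlinarith [s0, s1, s2, s3, hP]
  have := lt_of_pow_lt_pow_left₀ 2 (by positivity) hfin
  linarith

/-- The universal axis floor `(√(Δ² + 16t_pd²) − 3√(Δ² + 32t_pd²/3) + 3√(Δ² + 16t_pd²/3) − Δ)/16`.
[folklore] -/
def axisFloor (Δ tpd : ℝ) : ℝ :=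
  (Real.sqrt (Δ ^ 2 + 16 * tpd ^ 2) - 3 * Real.sqrt (Δ ^ 2 + 32 * tpd ^ 2 / 3)
    + 3 * Real.sqrt (Δ ^ 2 + 16 * tpd ^ 2 / 3) - Δ) / 16

/-- `axisFloor > 0` for `Δ ≥ 0`, `t_pd ≠ 0`. [folklore] -/
theorem axisFloor_pos {Δ tpd : ℝ} (hΔ : 0 ≤ Δ) (htpd : tpd ≠ 0) : 0 < axisFloor Δ tpd := by
  unfold axisFloor
  have hδ : 0 < 16 * tpd ^ 2 / 3 := by positivity
  have h := thirdDiff_sqrt_pos (sq_nonneg Δ) hδ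
  have e3 : Δ ^ 2 + 3 * (16 * tpd ^ 2 / 3) = Δ ^ 2 + 16 * tpd ^ 2 := by ring
  have e2 : Δ ^ 2 + 2 * (16 * tpd ^ 2 / 3) = Δ ^ 2 + 32 * tpd ^ 2 / 3 := by ring
  have e1 : Δ ^ 2 + 16 * tpd ^ 2 / 3 = Δ ^ 2 + 16 * tpd ^ 2 / 3 := rfl
  rw [e3, e2] at h
  rw [Real.sqrt_sq hΔ] at h
  linarith

/-- The third difference of the axis band at `x = 0, ⅓, ⅔, 1` equals `8·axisFloor` (`Δ ≥ 0`).
[folklore] -/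
theorem thirdDiff_axisBand {Δ : ℝ} (hΔ : 0 ≤ Δ) (tpd : ℝ) :
    axisBand Δ tpd 1 - 3 * axisBand Δ tpd (2 / 3) + 3 * axisBand Δ tpd (1 / 3) - axisBand Δ tpd 0
      = 8 * axisFloor Δ tpd := by
  unfold axisBand axisFloor
  have e0 : Real.sqrt (Δ ^ 2 + 16 * tpd ^ 2 * 0) = Δ := by
    rw [mul_zero, add_zero, Real.sqrt_sq hΔ]
  have e1 : Δ ^ 2 + 16 * tpd ^ 2 * (1 / 3) = Δ ^ 2 + 16 * tpd ^ 2 / 3 := by ring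
  have e2 : Δ ^ 2 + 16 * tpd ^ 2 * (2 / 3) = Δ ^ 2 + 32 * tpd ^ 2 / 3 := by ring
  rw [e0, e1, e2, mul_one]
  ring

/-- The third difference annihilates every one-band form on the axis (it is a quadratic in `x` there).
[folklore] -/
theorem thirdDiff_oneBandXY_axis (c t t' t'' : ℝ) :
    oneBandXY c t t' t'' 1 0 - 3 * oneBandXY c t t' t'' (2 / 3) 0 + 3 * oneBandXY c t t' t'' (1 / 3) 0
      - oneBandXY c t t' t'' 0 0 = 0 := by
  unfold oneBandXY
  ring

/-- THE UNIVERSAL AXIS FLOOR: for `Δ ≥ 0` (any `t_pd`, `t_pp`; `t_pp′ = 0`) and EVERY one-band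
`(c, t, t′, t″)`, the largest of the four misfits `|ε_AB(x, 0) − ε₁(x, 0)|` at `x = sin²(kx/2) ∈
{0, ⅓, ⅔, 1}` on the Γ–X axis is at least `axisFloor(Δ, t_pd)` — which is `> 0` whenever `t_pd ≠ 0`
(`axisFloor_pos`): NO energy-independent `t–t′–t″` dispersion reproduces the σ three-band antibonding band.
[cite: AndersenEtAl1995, §6 («for realistic values … hopping to second and third neighbors must be
included»)] -/
theorem axis_misfit_floor {Δ : ℝ} (hΔ : 0 ≤ Δ) (tpd tpp c t t' t'' : ℝ) :
    axisFloor Δ tpd ≤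
      max (max |abBand Δ tpd tpp 0 0 0 - oneBandXY c t t' t'' 0 0|
               |abBand Δ tpd tpp 0 (1 / 3) 0 - oneBandXY c t t' t'' (1 / 3) 0|)
          (max |abBand Δ tpd tpp 0 (2 / 3) 0 - oneBandXY c t t' t'' (2 / 3) 0|
               |abBand Δ tpd tpp 0 1 0 - oneBandXY c t t' t'' 1 0|) := by
  set M := max (max |abBand Δ tpd tpp 0 0 0 - oneBandXY c t t' t'' 0 0|
               |abBand Δ tpd tpp 0 (1 / 3) 0 - oneBandXY c t t' t'' (1 / 3) 0|)
          (max |abBand Δ tpd tpp 0 (2 / 3) 0 - oneBandXY c t t' t'' (2 / 3) 0|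
               |abBand Δ tpd tpp 0 1 0 - oneBandXY c t t' t'' 1 0|) with hM
  rw [abBand_axis hΔ tpd tpp (le_refl 0), abBand_axis hΔ tpd tpp (by norm_num : (0:ℝ) ≤ 1 / 3),
    abBand_axis hΔ tpd tpp (by norm_num : (0:ℝ) ≤ 2 / 3), abBand_axis hΔ tpd tpp zero_le_one] at hM
  have a0 : |axisBand Δ tpd 0 - oneBandXY c t t' t'' 0 0| ≤ M := by
    rw [hM]; exact le_trans (le_max_left _ _) (le_max_left _ _)
  have a1 : |axisBand Δ tpd (1 / 3) - oneBandXY c t t' t'' (1 / 3) 0| ≤ M := by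
    rw [hM]; exact le_trans (le_max_right _ _) (le_max_left _ _)
  have a2 : |axisBand Δ tpd (2 / 3) - oneBandXY c t t' t'' (2 / 3) 0| ≤ M := by
    rw [hM]; exact le_trans (le_max_left _ _) (le_max_right _ _)
  have a3 : |axisBand Δ tpd 1 - oneBandXY c t t' t'' 1 0| ≤ M := by
    rw [hM]; exact le_trans (le_max_right _ _) (le_max_right _ _)
  have d0 := (abs_le.mp a0)
  have d1 := (abs_le.mp a1)
  have d2 := (abs_le.mp a2)
  have d3 := (abs_le.mp a3)
  have hT := thirdDiff_axisBand hΔ tpd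
  have hQ := thirdDiff_oneBandXY_axis c t t' t''
  -- 8·axisFloor = Σ signed misfits ≤ 8 M
  have : 8 * axisFloor Δ tpd ≤ 8 * M := by linarith [d0.1, d0.2, d1.1, d1.2, d2.1, d2.2, d3.1, d3.2]
  linarith


/-! ## §3 Reviewer's appendix (hubbard-downfold-unc-3 REVIEW v3, 2026-08-27): the sign twin of the certificate
theorem and its composed k-space form (§1–§2 above byte-stable) -/

/-- Pointwise sign flip of the certified lower end under `w ↦ −w`. [folklore] -/
theorem ite_neg_weight (w ν μ : ℝ) :
    (if 0 ≤ -w then -w * ν else -w * μ) = -(if 0 ≤ w then w * μ else w * ν) := by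
  rcases lt_trichotomy w 0 with hw | hw | hw
  · rw [if_pos (by linarith), if_neg (by linarith)]; ring
  · subst hw; simp
  · rw [if_neg (by linarith), if_pos hw.le]; ring

/-- THE SIGN TWIN (reviewer's item (c)): the same certificate with the opposite orientation of the weights —
`δ·Σ|w_i| < −Σ (w_i μ_i if w_i ≥ 0 else w_i ν_i)` certifies the floor as well (apply the theorem to `−w`).
[folklore] -/
theorem misfit_floor_of_certificate_neg {ι : Type*} (s : Finset ι) (w x y ν μ : ι → ℝ)
    (Δ tpd tpp cc δ : ℝ)
    (h0 : ∑ i ∈ s, w i = 0) (h1 : ∑ i ∈ s, w i * (x i + y i) = 0)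
    (h2 : ∑ i ∈ s, w i * (x i * y i) = 0) (h3 : ∑ i ∈ s, w i * (x i ^ 2 + y i ^ 2) = 0)
    (henc : ∀ i ∈ s, ν i ≤ abBand Δ tpd tpp cc (x i) (y i) ∧ abBand Δ tpd tpp cc (x i) (y i) ≤ μ i)
    (hδ : δ * ∑ i ∈ s, |w i| < -∑ i ∈ s, (if 0 ≤ w i then w i * μ i else w i * ν i))
    (c t t' t'' : ℝ) :
    ∃ i ∈ s, δ < |abBand Δ tpd tpp cc (x i) (y i) - oneBandXY c t t' t'' (x i) (y i)| := by
  have h0' : ∑ i ∈ s, (fun j => -w j) i = 0 := by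
    simp only [Finset.sum_neg_distrib, h0, neg_zero]
  have h1' : ∑ i ∈ s, (fun j => -w j) i * (x i + y i) = 0 := by
    simp only [neg_mul, Finset.sum_neg_distrib, h1, neg_zero]
  have h2' : ∑ i ∈ s, (fun j => -w j) i * (x i * y i) = 0 := by
    simp only [neg_mul, Finset.sum_neg_distrib, h2, neg_zero]
  have h3' : ∑ i ∈ s, (fun j => -w j) i * (x i ^ 2 + y i ^ 2) = 0 := by
    simp only [neg_mul, Finset.sum_neg_distrib, h3, neg_zero]
  have habs : ∑ i ∈ s, |(fun j => -w j) i| = ∑ i ∈ s, |w i| := by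
    apply Finset.sum_congr rfl
    intro i _
    exact abs_neg _
  have hδ' : δ * ∑ i ∈ s, |(fun j => -w j) i| <
      ∑ i ∈ s, (if 0 ≤ (fun j => -w j) i then (fun j => -w j) i * ν i else (fun j => -w j) i * μ i) := by
    rw [habs]
    have hsum : ∑ i ∈ s, (if 0 ≤ (fun j => -w j) i then (fun j => -w j) i * ν i else (fun j => -w j) i * μ i)
        = -∑ i ∈ s, (if 0 ≤ w i then w i * μ i else w i * ν i) := by
      rw [← Finset.sum_neg_distrib]
      apply Finset.sum_congr rfl
      intro i _
      exact ite_neg_weight (w i) (ν i) (μ i)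
    rw [hsum]
    exact hδ
  exact misfit_floor_of_certificate s (fun j => -w j) x y ν μ Δ tpd tpp cc δ h0' h1' h2' h3' henc hδ' c t t' t''

/-- THE COMPOSED k-SPACE FORM (reviewer's item (d)): with the certificate points inside the unit square,
the conclusion is a statement at the explicit k-points `k_i = (2·arcsin √x_i, 2·arcsin √y_i)` about the D0
one-band dispersion `EmeryBlochBand.oneBand` itself: every `t–t′–t″` dispersion misses the antibonding band by
more than `δ` at one of them. [folklore] -/
theorem misfit_floor_of_certificate_k {ι : Type*} (s : Finset ι) (w x y ν μ : ι → ℝ)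
    (Δ tpd tpp cc δ : ℝ)
    (hx : ∀ i ∈ s, 0 ≤ x i ∧ x i ≤ 1) (hy : ∀ i ∈ s, 0 ≤ y i ∧ y i ≤ 1)
    (h0 : ∑ i ∈ s, w i = 0) (h1 : ∑ i ∈ s, w i * (x i + y i) = 0)
    (h2 : ∑ i ∈ s, w i * (x i * y i) = 0) (h3 : ∑ i ∈ s, w i * (x i ^ 2 + y i ^ 2) = 0)
    (henc : ∀ i ∈ s, ν i ≤ abBand Δ tpd tpp cc (x i) (y i) ∧ abBand Δ tpd tpp cc (x i) (y i) ≤ μ i)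
    (hδ : δ * ∑ i ∈ s, |w i| < ∑ i ∈ s, (if 0 ≤ w i then w i * ν i else w i * μ i))
    (c t t' t'' : ℝ) :
    ∃ i ∈ s, δ < |abBand Δ tpd tpp cc (x i) (y i)
      - oneBand c t t' t'' (2 * Real.arcsin (Real.sqrt (x i))) (2 * Real.arcsin (Real.sqrt (y i)))| := by
  obtain ⟨i, hi, h⟩ := misfit_floor_of_certificate s w x y ν μ Δ tpd tpp cc δ h0 h1 h2 h3 henc hδ c t t' t''
  refine ⟨i, hi, ?_⟩
  rw [oneBand_eq_oneBandXY, sin_sq_half_two_arcsin_sqrt (hx i hi).1 (hx i hi).2,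
    sin_sq_half_two_arcsin_sqrt (hy i hi).1 (hy i hi).2]
  exact h

end Summit.Ventures.CertifiedManyBodySolver.Downfold.Emery
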